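import Summits.QuantumFields.YangMills.Theorems.UnitScaleTiltProp7SliceRowOfFilling
import HarnessLib

/-!
# Route `UnitScaleTilt`, crux K1 «MinimiserStabilityRegPr» (stmt-QuantumFields-19200) — route-R E′ (A′)-comb, COMB-FLAT-COERCIVITY ⟸ (I3′) (px13 ✓p698599), (I3′) organisation of record
# := PLAN B (px22 g5 LOCATE ac2baf06, adopted 05:54Z): **THE SLICE ROW FROM A DIRECT `ℓ²` BOUND ON THE CARRIERS** — the sibling of ✓`Prop7SliceRowOfFilling` (this seat, p699033∕p700220)
# in which NO filling 2-chain is materialised: the one-step telescope delivers `Σ_c Σ_{jj′}|δQ̃X(c)_{jj′}|² ≤ A′·Σ_p Σ_{jj′}|curl 1 X p_{jj′}|²` with `A′ = 81C(L)∕ℓ`, and that is all (hv) needs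

Cell `ym3-torus`, width seat `ym-ust-19200-w4` (gen 8; (I3′) LOCATE-first taker).  THEOREMS ONLY (0 `def`, 0 `sorry`); `--supports stmt-QuantumFields-19200`, count-neutral.  YM₃ on T³ is
a ladder rung (R3), not the Clay problem; nothing here claims (I3′), COMB-FLAT-COERCIVITY, `norm_G₀ᶜ`, hcoS, E′, EX, the crux, d = 4 or the mass gap.

WHAT IS PROVED (ns `…Theorems.Prop7SliceRowOfSqBound`): ★★`norm_sq_le_of_sqBound` (any map `δ`: `‖δ(toL2 X)‖² ≤ cB·A′·Σ|curl|²` from the carrier `ℓ²` bound, ✓`norm_sq_toL2B`),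
★`sliceRow_of_sqBound` (`a‖δ y‖² ≤ (a·cB·A′·η²∕c₀)·re⟨y, Δ^η(1)y⟩`, ✓`re_inner_DeltaEta_one`), ★★★`sliceBound_basePt_of_sqBound` — px13 g6's displayed `hv` of
✓`coercive_laplaceAc_one_of_sliceBound_basePt` VERBATIM from `hT : ∀ X, Σ_c Σ_{jj′}|toL2B⁻¹(Q_kᶜ(1)(toL2 (X∘translate(−basePt))) − Q_k(1)(toL2 X))(c)_{jj′}|² ≤ A′·Σ_p Σ_{jj′}|curl 1 X p_{jj′}|²` with
**`ρ := a₀·A′·L^{K−n}`** (K-uniform iff `A′·ℓ ≤ C_L`), ★★★`coercive_laplaceAc_one_of_sqBound` (end-to-end: `(1∕(4·Cst 3 a₀·(2 + 2a₀A′ℓ)))‖y‖² ≤ re⟨y, Δ_aᶜ(1)y⟩`).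
HONEST SCOPE: bookkeeping; the bound `hT` (PLAN B P1–P4) is NOT proved here; (I3′)∕COMB-FLAT∕A6ᶜ OPEN.  Rung R3, not Clay; YM gap NOT proved.

References: T. Bałaban, CMP 99 (1985) 389–434 [Balaban1985BackgroundPropagators] ((3.16) p.393, (3.26) p.395, Thm 3.11 p.416); CMP 102 (1985) 277–309 [Balaban1985Variational] ((44)–(45) p.285).
-/

noncomputable section

open scoped InnerProductSpace ComplexConjugate Matrix.Norms.L2Operator BigOperators

namespace Summit.QuantumFields.YangMills.Theorems.Prop7SliceRowOfSqBound

open Literature.MathematicalPhysics.QuantumFieldTheory.Balaban1983to89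
open Literature.MathematicalPhysics.QuantumFieldTheory.Balaban1983to89.T3ContinuumYM3Torus
open T3SectALandauChart (eta eta_pos)
open LatticeFieldCalculus (curl)
open B9Eq311L2Pairing (WL2)
open B11Eq103H1Complex (SiteL2K BondL2K)
open Summit.QuantumFields.YangMills.Theorems.Prop7SectET3Transport (periodsT3)
open Summit.QuantumFields.YangMills.Theorems.Prop7SectET3HilbertLetters (W₂ toL2 toL2B DL2 DstarL2)
open Summit.QuantumFields.YangMills.Theorems.Prop7SectET3GaugeProjector (RS)
open Summit.QuantumFields.YangMills.Theorems.Prop7SectET3WilsonHessian (DeltaEta)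
open Summit.QuantumFields.YangMills.Theorems.Prop7SectET3CurvedPropagators (Qk)
open Summit.QuantumFields.YangMills.Theorems.Prop7SectET3CombLetters (Qkc laplaceAc)
open Summit.QuantumFields.YangMills.Theorems.Prop7LaplaceAFlatLetters (re_inner_DeltaEta_one norm_sq_toL2B)
open Summit.QuantumFields.YangMills.Theorems.Prop7SPrint (basePt)
open Summit.QuantumFields.YangMills.Theorems.Prop7CombFlatProjectorTransport (coercive_laplaceAc_one_of_sliceBound_basePt)

variable {F : T3Family} {n K : ℕ} {c₀ cB : ℝ}


/-- ★★ **THE DEFECT NORM FROM AN `ℓ²` BOUND ON THE CARRIERS**: if `Σ_c Σ_{jj′} |toL2B⁻¹(δ(toL2 X))(c)_{jj′}|² ≤ A′·Σ_p Σ_{jj′} |curl 1 X p_{jj′}|²` for all `X`, then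
`‖δ(toL2 X)‖² ≤ cB·A′·Σ_p Σ_{jj′}|curl 1 X p_{jj′}|²` (✓`norm_sq_toL2B`). [cite: Balaban1985BackgroundPropagators, (3.16) p.393] -/
theorem norm_sq_le_of_sqBound [Fact (0 < cB)]
    (δ : BondL2K ℂ 3 (periodsT3 F K) c₀ W₂ → WL2 ℂ (fun _ : PBond (F.P n) 0 => cB) W₂) {A' : ℝ}
    (hT : ∀ X : PBond (F.P K) 0 → Matrix (Fin 2) (Fin 2) ℂ,
      ∑ c : PBond (F.P n) 0, ∑ i, ∑ i', ‖(toL2B F n cB).symm (δ (toL2 F K c₀ X)) c i i'‖ ^ 2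
        ≤ A' * ∑ p : Plaq (F.P K) 0, ∑ i, ∑ i', ‖curl 1 X p i i'‖ ^ 2)
    (X : PBond (F.P K) 0 → Matrix (Fin 2) (Fin 2) ℂ) :
    ‖δ (toL2 F K c₀ X)‖ ^ 2 ≤ cB * A' * ∑ p : Plaq (F.P K) 0, ∑ i, ∑ i', ‖curl 1 X p i i'‖ ^ 2 := by
  have hcB : 0 < cB := Fact.out
  have hTB : δ (toL2 F K c₀ X) = toL2B F n cB ((toL2B F n cB).symm (δ (toL2 F K c₀ X))) := ((toL2B F n cB).apply_symm_apply _).symm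
  rw [hTB, norm_sq_toL2B, mul_assoc]
  exact mul_le_mul_of_nonneg_left (hT X) hcB.le

/-- ★ **THE SLICE ROW FROM THE `ℓ²` BOUND**: `a·‖δ y‖² ≤ (a·cB·A′·η²∕c₀)·re⟨y, Δ^η(1) y⟩` (✓`re_inner_DeltaEta_one`). [cite: Balaban1985BackgroundPropagators, (3.4) p.391, (3.26) p.395] -/
theorem sliceRow_of_sqBound [Fact (0 < c₀)] [Fact (0 < cB)]
    (δ : BondL2K ℂ 3 (periodsT3 F K) c₀ W₂ → WL2 ℂ (fun _ : PBond (F.P n) 0 => cB) W₂) {A' : ℝ}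
    (hT : ∀ X : PBond (F.P K) 0 → Matrix (Fin 2) (Fin 2) ℂ,
      ∑ c : PBond (F.P n) 0, ∑ i, ∑ i', ‖(toL2B F n cB).symm (δ (toL2 F K c₀ X)) c i i'‖ ^ 2
        ≤ A' * ∑ p : Plaq (F.P K) 0, ∑ i, ∑ i', ‖curl 1 X p i i'‖ ^ 2)
    {a : ℝ} (ha : 0 ≤ a) (y : BondL2K ℂ 3 (periodsT3 F K) c₀ W₂) :
    a * ‖δ y‖ ^ 2 ≤ (a * cB * A' * (eta F n K) ^ 2 / c₀) * RCLike.re ⟪y, DeltaEta F n K c₀ 1 y⟫_ℂ := by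
  have hc₀ : 0 < c₀ := Fact.out
  have hη : 0 < eta F n K := eta_pos F n K
  obtain ⟨X, rfl⟩ : ∃ X, toL2 F K c₀ X = y := ⟨(toL2 F K c₀).symm y, (toL2 F K c₀).apply_symm_apply y⟩
  rw [re_inner_DeltaEta_one]
  have h1 := norm_sq_le_of_sqBound δ hT X
  have hkey : (a * cB * A' * (eta F n K) ^ 2 / c₀) * (c₀ * (eta F n K)⁻¹ ^ 2 * ∑ p : Plaq (F.P K) 0, ∑ i, ∑ i', ‖curl 1 X p i i'‖ ^ 2)
      = a * (cB * A' * ∑ p : Plaq (F.P K) 0, ∑ i, ∑ i', ‖curl 1 X p i i'‖ ^ 2) := by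
    field_simp
  rw [hkey]
  exact mul_le_mul_of_nonneg_left h1 ha

/-- ★★★ **(I3′) ⟸ THE ONE-STEP `ℓ²` BOUND, IN THE LETTERS OF RECORD** (px22 g5 PLAN B §6): if for all `X`
`Σ_c Σ_{jj′} |toL2B⁻¹(Q_kᶜ(1)(toL2 (X∘translate(−basePt))) − Q_k(1)(toL2 X))(c)_{jj′}|² ≤ A′·Σ_p Σ_{jj′}|curl 1 X p_{jj′}|²` (`A′ ≥ 0`), then px13's displayed `hv` holds with **`ρ := a₀·A′·L^{K−n}`**
— K-uniform iff `A′·ℓ ≤ C_L` (PLAN B: `A′ = 81C(L)∕ℓ`).  No 2-chain is materialised. [cite: Balaban1985BackgroundPropagators, (3.26) p.395, Thm 3.11 p.416] -/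
theorem sliceBound_basePt_of_sqBound {h : n ≤ K} [Fact (0 < c₀)] [Fact (0 < cB)]
    (Δx : GaugeField (F.P K) 0 (Matrix.specialUnitaryGroup (Fin 2) ℂ) → (BondL2K ℂ 3 (periodsT3 F K) c₀ W₂ →ₗ[ℂ] BondL2K ℂ 3 (periodsT3 F K) c₀ W₂))
    (hΔ : Δx 1 = (DeltaEta F n K c₀ 1 : BondL2K ℂ 3 (periodsT3 F K) c₀ W₂ →ₗ[ℂ] BondL2K ℂ 3 (periodsT3 F K) c₀ W₂))
    {A' : ℝ} (hA' : 0 ≤ A')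
    (hT : ∀ X : PBond (F.P K) 0 → Matrix (Fin 2) (Fin 2) ℂ,
      ∑ c : PBond (F.P n) 0, ∑ i, ∑ i',
        ‖(toL2B F n cB).symm
            (Qkc F n K h c₀ cB (1 : GaugeField (F.P K) 0 (Matrix.specialUnitaryGroup (Fin 2) ℂ)) (toL2 F K c₀ (fun b => X (b.translate (-basePt F n K))))
              - Qk F n K h c₀ cB (1 : GaugeField (F.P K) 0 (Matrix.specialUnitaryGroup (Fin 2) ℂ)) (toL2 F K c₀ X)) c i i'‖ ^ 2
        ≤ A' * ∑ p : Plaq (F.P K) 0, ∑ i, ∑ i', ‖curl 1 X p i i'‖ ^ 2)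
    {a₀ : ℝ} (ha₀ : 0 ≤ a₀) (X : PBond (F.P K) 0 → Matrix (Fin 2) (Fin 2) ℂ) :
    (a₀ * (c₀ / cB) * ((F.L : ℝ) ^ (K - n)) ^ 3)
        * ‖Qkc F n K h c₀ cB (1 : GaugeField (F.P K) 0 (Matrix.specialUnitaryGroup (Fin 2) ℂ)) (toL2 F K c₀ (fun b => X (b.translate (-basePt F n K))))
            - Qk F n K h c₀ cB (1 : GaugeField (F.P K) 0 (Matrix.specialUnitaryGroup (Fin 2) ℂ)) (toL2 F K c₀ X)‖ ^ 2
      ≤ (a₀ * A' * (F.L : ℝ) ^ (K - n))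
          * (RCLike.re ⟪toL2 F K c₀ X, Δx 1 (toL2 F K c₀ X)⟫_ℂ
              + ‖RS F n K h c₀ cB (1 : GaugeField (F.P K) 0 (Matrix.specialUnitaryGroup (Fin 2) ℂ))
                  (DstarL2 F n K c₀ (1 : GaugeField (F.P K) 0 (Matrix.specialUnitaryGroup (Fin 2) ℂ)) (toL2 F K c₀ X))‖ ^ 2) := by
  have hc₀ : 0 < c₀ := Fact.out
  have hcB : 0 < cB := Fact.out
  have hL : (0 : ℝ) < F.L := by exact_mod_cast lt_trans zero_lt_one F.hL.2
  have ha : 0 ≤ a₀ * (c₀ / cB) * ((F.L : ℝ) ^ (K - n)) ^ 3 := by positivity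
  -- the carrier translation as a map of the Hilbert carrier, and the defect map
  set τ : BondL2K ℂ 3 (periodsT3 F K) c₀ W₂ → BondL2K ℂ 3 (periodsT3 F K) c₀ W₂ :=
    fun y => toL2 F K c₀ (fun b => (toL2 F K c₀).symm y (b.translate (-basePt F n K))) with hτ_def
  have hτ : ∀ Y : PBond (F.P K) 0 → Matrix (Fin 2) (Fin 2) ℂ, τ (toL2 F K c₀ Y) = toL2 F K c₀ (fun b => Y (b.translate (-basePt F n K))) := fun Y => by
    simp only [hτ_def, LinearEquiv.symm_apply_apply]
  set δ : BondL2K ℂ 3 (periodsT3 F K) c₀ W₂ → WL2 ℂ (fun _ : PBond (F.P n) 0 => cB) W₂ :=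
    fun y => Qkc F n K h c₀ cB (1 : GaugeField (F.P K) 0 (Matrix.specialUnitaryGroup (Fin 2) ℂ)) (τ y)
      - Qk F n K h c₀ cB (1 : GaugeField (F.P K) 0 (Matrix.specialUnitaryGroup (Fin 2) ℂ)) y with hδ_def
  have hT' : ∀ Y : PBond (F.P K) 0 → Matrix (Fin 2) (Fin 2) ℂ,
      ∑ c : PBond (F.P n) 0, ∑ i, ∑ i', ‖(toL2B F n cB).symm (δ (toL2 F K c₀ Y)) c i i'‖ ^ 2
        ≤ A' * ∑ p : Plaq (F.P K) 0, ∑ i, ∑ i', ‖curl 1 Y p i i'‖ ^ 2 := fun Y => by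
    simp only [hδ_def, hτ Y]
    exact hT Y
  have h1 := sliceRow_of_sqBound (n := n) δ hT' ha (toL2 F K c₀ X)
  simp only [hδ_def, hτ X] at h1
  -- the constant: `a·cB·A′·η²∕c₀ = a₀·A′·ℓ`
  have hηℓ : eta F n K * (F.L : ℝ) ^ (K - n) = 1 := by
    rw [eta, inv_pow]
    exact inv_mul_cancel₀ (pow_ne_zero _ hL.ne')
  have hconst : a₀ * (c₀ / cB) * ((F.L : ℝ) ^ (K - n)) ^ 3 * cB * A' * (eta F n K) ^ 2 / c₀ = a₀ * A' * (F.L : ℝ) ^ (K - n) := by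
    have hw : c₀ / cB * cB / c₀ = 1 := by field_simp
    calc a₀ * (c₀ / cB) * ((F.L : ℝ) ^ (K - n)) ^ 3 * cB * A' * (eta F n K) ^ 2 / c₀
        = a₀ * A' * (F.L : ℝ) ^ (K - n) * (eta F n K * (F.L : ℝ) ^ (K - n)) ^ 2 * (c₀ / cB * cB / c₀) := by ring
      _ = a₀ * A' * (F.L : ℝ) ^ (K - n) := by rw [hηℓ, hw]; ring
  rw [hconst] at h1
  have hρ : 0 ≤ a₀ * A' * (F.L : ℝ) ^ (K - n) := by positivity
  have hre : RCLike.re ⟪toL2 F K c₀ X, DeltaEta F n K c₀ 1 (toL2 F K c₀ X)⟫_ℂ ≤ RCLike.re ⟪toL2 F K c₀ X, DeltaEta F n K c₀ 1 (toL2 F K c₀ X)⟫_ℂ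
      + ‖RS F n K h c₀ cB (1 : GaugeField (F.P K) 0 (Matrix.specialUnitaryGroup (Fin 2) ℂ))
          (DstarL2 F n K c₀ (1 : GaugeField (F.P K) 0 (Matrix.specialUnitaryGroup (Fin 2) ℂ)) (toL2 F K c₀ X))‖ ^ 2 :=
    le_add_of_nonneg_right (sq_nonneg _)
  have hslot : RCLike.re ⟪toL2 F K c₀ X, Δx 1 (toL2 F K c₀ X)⟫_ℂ = RCLike.re ⟪toL2 F K c₀ X, DeltaEta F n K c₀ 1 (toL2 F K c₀ X)⟫_ℂ := by rw [hΔ]; rfl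
  rw [hslot]
  exact h1.trans (mul_le_mul_of_nonneg_left hre hρ)

/-- ★★★ **COMB-FLAT COERCIVITY FROM THE ONE-STEP `ℓ²` BOUND — END-TO-END** (✓p698599 ∘ §7): `(1∕(4·Cst 3 a₀·(2 + 2·a₀A′ℓ)))·‖y‖² ≤ re⟨y, Δ_aᶜ(1) y⟩`.
[cite: Balaban1985BackgroundPropagators, (3.26) p.395, Thm 3.11 p.416] -/
theorem coercive_laplaceAc_one_of_sqBound {h : n ≤ K} [Fact (0 < c₀)] [Fact (0 < cB)] {a₀ : ℝ} (ha₀ : 0 < a₀)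
    (Δx : GaugeField (F.P K) 0 (Matrix.specialUnitaryGroup (Fin 2) ℂ) → (BondL2K ℂ 3 (periodsT3 F K) c₀ W₂ →ₗ[ℂ] BondL2K ℂ 3 (periodsT3 F K) c₀ W₂))
    (hΔ : Δx 1 = (DeltaEta F n K c₀ 1 : BondL2K ℂ 3 (periodsT3 F K) c₀ W₂ →ₗ[ℂ] BondL2K ℂ 3 (periodsT3 F K) c₀ W₂))
    {A' : ℝ} (hA' : 0 ≤ A')
    (hT : ∀ X : PBond (F.P K) 0 → Matrix (Fin 2) (Fin 2) ℂ,
      ∑ c : PBond (F.P n) 0, ∑ i, ∑ i',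
        ‖(toL2B F n cB).symm
            (Qkc F n K h c₀ cB (1 : GaugeField (F.P K) 0 (Matrix.specialUnitaryGroup (Fin 2) ℂ)) (toL2 F K c₀ (fun b => X (b.translate (-basePt F n K))))
              - Qk F n K h c₀ cB (1 : GaugeField (F.P K) 0 (Matrix.specialUnitaryGroup (Fin 2) ℂ)) (toL2 F K c₀ X)) c i i'‖ ^ 2
        ≤ A' * ∑ p : Plaq (F.P K) 0, ∑ i, ∑ i', ‖curl 1 X p i i'‖ ^ 2)
    (y : BondL2K ℂ 3 (periodsT3 F K) c₀ W₂) :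
    (1 / (4 * B5Prop11Plancherel.Cst 3 a₀ * (2 + 2 * (a₀ * A' * (F.L : ℝ) ^ (K - n))))) * ‖y‖ ^ 2
      ≤ RCLike.re ⟪y, laplaceAc F n K h c₀ cB (a₀ * (c₀ / cB) * ((F.L : ℝ) ^ (K - n)) ^ 3) Δx
          (1 : GaugeField (F.P K) 0 (Matrix.specialUnitaryGroup (Fin 2) ℂ)) y⟫_ℂ := by
  have hρ : 0 ≤ a₀ * A' * (F.L : ℝ) ^ (K - n) := by
    have hL : (0 : ℝ) < F.L := by exact_mod_cast lt_trans zero_lt_one F.hL.2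
    have := ha₀.le
    positivity
  exact coercive_laplaceAc_one_of_sliceBound_basePt (n := n) ha₀ Δx hΔ hρ
    (fun X => sliceBound_basePt_of_sqBound Δx hΔ hA' hT ha₀.le X) y

end Summit.QuantumFields.YangMills.Theorems.Prop7SliceRowOfSqBound

end
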